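import Literature.AlgebraicGeometry.Motives.SeesawTheorem
import HarnessLib

/-!
# The base change square `X ×_K T' → X ×_K T` over `T' → T` is cartesian

For `K`-schemes `X`, `T`, `T'` and a `K`-morphism `f : T' → T` the square
```
X ×_K T' ——X ◁ f——→ X ×_K T
   |pr_{T'}            |pr_T
   T'   ————f————→     T
```
is cartesian (`X ×_K T' = (X ×_K T) ×_T T'`; Görtz–Wedhorn I, Prop. 4.16: transitivity of fibre
products). In the monoidal language of this directory (`SchemeOver K = Over (Spec K)` with its
cartesian monoidal structure, `X ◁ f = MonoidalCategory.whiskerLeft`) this is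
`isPullback_whiskerLeft_snd`, proved from Mathlib's pasting lemma `IsPullback.of_right` and the two
fibre squares over `Spec K` (`IsPullback.of_hasPullback`). The case `T' = Spec κ(t) → T`
(`residuePtι`) is the cartesian square of the fibre `X_t → X ×_K T` used for base change of
sections to the fibres (Görtz–Wedhorn II, (23.28.5); Mathlib `isIso_pushoutSection_of_isAffineOpen`
consumes exactly such an `IsPullback`). Mathlib searched (pin): `IsPullback.of_right`,
`IsPullback.of_hasPullback`, `CartesianMonoidalCategory.whiskerLeft_fst/snd` (used); Mathlib has
no such statement for `Over` categories with their cartesian monoidal structure.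

## References

* U. Görtz, T. Wedhorn, *Algebraic Geometry I: Schemes*, 2nd ed., Springer Spektrum (2020),
  doi:10.1007/978-3-658-30733-2: Prop. 4.16 and (4.8), pp. 101–104 (fibre products,
  transitivity, fibres of morphisms). [GortzWedhorn2020]
* U. Görtz, T. Wedhorn, *Algebraic Geometry II: Cohomology of Schemes*, Springer Spektrum (2023),
  doi:10.1007/978-3-658-43031-3: (23.28.1), (23.28.5), pp. 480–482. [GortzWedhorn2023]
-/

universe u

open CategoryTheory CategoryTheory.Limits AlgebraicGeometry MonoidalCategory
open CartesianMonoidalCategory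

noncomputable section

namespace Literature.AlgebraicGeometry.Motives

variable {K : Type u} [Field K] (X : SchemeOver K) {T T' : SchemeOver K} (f : T' ⟶ T)

/-- **`X ×_K T' ≅ (X ×_K T) ×_T T'`**: the square `(X ◁ f, pr_{T'}; pr_T, f)` is cartesian
(Görtz–Wedhorn I, Prop. 4.16). [cite: GortzWedhorn2020, Prop. 4.16 (p. 101)] -/
theorem isPullback_whiskerLeft_snd :
    IsPullback (X ◁ f).left (snd X T').left (snd X T).left f.left := by
  -- the big square `X × T' → X` over `T' → Spec K` and the right square `X × T → X` over `T → Spec K`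
  have big : IsPullback ((X ◁ f).left ≫ (fst X T).left) (snd X T').left X.hom (f.left ≫ T.hom) := by
    have e₁ : (X ◁ f).left ≫ (fst X T).left = (fst X T').left := by
      rw [← Over.comp_left, whiskerLeft_fst]
    have e₂ : f.left ≫ T.hom = T'.hom := Over.w f
    rw [e₁, e₂]
    exact IsPullback.of_hasPullback X.hom T'.hom
  have comm : (X ◁ f).left ≫ (snd X T).left = (snd X T').left ≫ f.left := by
    rw [← Over.comp_left, whiskerLeft_snd, Over.comp_left]
  exact IsPullback.of_right big comm (IsPullback.of_hasPullback X.hom T.hom)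

/-- **The fibre square**: `X_t = X ×_K Spec κ(t) → X ×_K T` over `Spec κ(t) → T` is cartesian
(`residuePt`, `residuePtι` of `Motives/SeesawTheorem`). [cite: GortzWedhorn2020, Prop. 4.16 (p. 101) and Section (4.8)] -/
theorem isPullback_whiskerLeft_residuePtι (T : SchemeOver K) (t : T.left) :
    IsPullback (X ◁ residuePtι T t).left (snd X (residuePt T t)).left (snd X T).left
      (T.left.fromSpecResidueField t) :=
  isPullback_whiskerLeft_snd X (residuePtι T t)

end Literature.AlgebraicGeometry.Motives

end
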